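import Mathlib
import HarnessLib
import Summits.HubbardSuperconductivity.HubbardSuperconductivity.Theorems.KLProgrammeKLRegimeEngineTowerProfiles

/-!
# Route `KLProgramme` — crux K3 ENGINE (gen 8 engine-flow child stmt-HubbardSuperconductivity-20437 `KLRegimeEngineV17F2`), stub (b)
# `stub_engine_step_norms`: the DIMENSIONLESS BLOCKED-TOWER BOOKKEEPING, part 2 — the closed-form block step (T2) and the induction (T3)
# (E1 lead r2d-p2 g5, memo E1-TOWER-BLOCKED §7, evidence #4 on 20437)

Continuation of `…EngineTowerProfiles` (defs `towerFO/towerV/towerS`, T1/T1′, the geometric-profile bounds).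

* **`towerStep_le_profile`** (T2) — the block step in the form the Grassmann suppliers give it (for every cumulant order `N ≥ 2`, under the
  convergence guard `Φ·V < 1`: `b ≤ FO(p) + Σ_{n=2}^{N} e Φ^{n−1} ψ^p S_n(p) + ψ^p e V (ΦV)^N/(1−ΦV)`), for inputs with profile `A' λ^{m−1} Q'^m`
  (`1 ≤ m ≤ D`) and the smallness conditions `x₁ = 4σλQ' < 1`, `2λτQ' ≤ 1`, `x₃ = eτλQ' < 1`, `y = 2A'ΦτQ' < 1`, `θ̄ = ΦA'eτQ'/(1−x₃) < 1`,
  gives the closed form `b ≤ A' λ^{p−1} [(4Q')^p x₁/(1−x₁) + e (2τψQ')^p y/(1−y)]` (the tail removed by `N → ∞`);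
* **`towerBorn_le_law`** (T3) — the induction over blocks: under (H0) the UV profile `b 0 p ≤ A λ^{p−1} Q^p`, (Hμ) blocked re-measurement
  `μ k m ≤ Σ_{k'≤k} c₁c₂^m g^{(m−2)(k+1−k')} b k' m` (`m ≥ 3`) with `A' ≥ c₁A/((1−g)g²)`, `Q' ≥ c₂gQ`, the two IMPORTED degrees inside the measured
  profile (`μ k 1 ≤ A'Q'` two-leg slot + frame shift; `μ k 2 ≤ A'λQ'²` value line), (Hstep) as in T2 at every `k < K`, and (Hnum) = T2's smallness
  + the BLOCKING conditions `4Q' ≤ Q`, `2τψQ' ≤ Q` (i.e. `4c₂g ≤ 1`, `2τψc₂g ≤ 1`: the block length, `d ≈ 10–11` for the tree's constants) + the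
  amplitude condition at `p = 3`, `A'[(4Q')³x₁/(1−x₁) + e(2τψQ')³y/(1−y)] ≤ AQ³`:  `∀ k ≤ K, ∀ 3 ≤ p ≤ D, b k p ≤ A λ^{p−1} Q^p` — uniformly in
  `D`, `K`, `N` (volume, number of scales, cumulant order).

How stub (b) uses it: `b`/`μ` := pinned sectorised norms of the increments of `klEffectiveAction … (klFlowFrameU … n) klE0 (J_k)` in families
`klAnisoFamily … (J_k)` / `(J_{k+1})` scaled by `2^{−(3m−5)J}`; (Hμ) from the subadditivity of the sectorised norm + the torus relative sector
count with exponent `L−3` (k3c2-p3 S2 / p4 U7 — load-bearing, memo §5) + re-sectorisation constants; (Hstep) from the binomial–Gram first order +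
G1 + block doors; the public `KernelNormsWt (klWtBudget …) … (K_n) j` / `KernelNormsV4` follow by T1′ + one partial-block step + p525701/p526991.
Pure real analysis; nothing about the model is asserted.  References: Benfatto–Giuliani–Mastropietro 2006 §2.8 (2.83), (2.93)–(2.98).
-/

noncomputable section

namespace Summit.HubbardSuperconductivity.HubbardSuperconductivity.Theorems.EngineV8

set_option linter.dupNamespace false -- summit = problem name (single-conjunct summit), D-0017

open Real Finset

/-! ## §2′ (T2) The block step in closed form -/

/-- `Σ_{n ∈ [2, N]} y^{n−1} ≤ y/(1−y)` for `0 ≤ y < 1`. -/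
theorem sum_Icc_two_pow_sub_one_le {y : ℝ} (hy0 : 0 ≤ y) (hy1 : y < 1) (N : ℕ) :
    ∑ n ∈ Icc 2 N, y ^ (n - 1) ≤ y / (1 - y) := by
  have hI : Icc 2 N = Ico 2 (N + 1) := by ext m; simp only [mem_Icc, mem_Ico]; omega
  rw [hI, sum_Ico_eq_sum_range]
  refine le_trans (le_of_eq (sum_congr rfl fun i _ => ?_)) (sum_range_pow_succ_le hy0 hy1 _)
  congr 1
  omega

/-- **(T2) The block step for inputs with a geometric profile, in closed form.**  Inputs `0 ≤ μ m ≤ A' λ^{m−1} Q'^m` on `[1, D]`; the step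
hypothesis for the output size `b` in degree `2p` (`1 ≤ p`) in the form the Grassmann suppliers give it — for every cumulant order `N ≥ 2`, under
the convergence guard `Φ·V < 1`: `b ≤ FO(p) + Σ_{n=2}^{N} e Φ^{n−1} ψ^p S_n(p) + ψ^p e V (ΦV)^N/(1 − ΦV)` (binomial–Gram first order; graded
orders `2 … N` in product form; the flat geometric tail); and the smallness conditions `x₁ = 4σλQ' < 1`, `2λτQ' ≤ 1`, `x₃ = eτλQ' < 1`,
`y = 2A'ΦτQ' < 1`, `θ̄ = Φ·A'eτQ'/(1−x₃) < 1`.  Then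
`b ≤ A' λ^{p−1} · [ (4Q')^p · x₁/(1−x₁) + e (2τψQ')^p · y/(1−y) ]` — the perturbative order `λ^{p−1}` with per-leg-pair constants `4Q'`
(first order) and `2τψQ'` (graded orders), the tail removed by `N → ∞`. -/
theorem towerStep_le_profile {D : ℕ} {μ : ℕ → ℝ} {b σ Φ ψ τ A' lam Q' : ℝ}
    (hσ : 0 ≤ σ) (hΦ : 0 ≤ Φ) (hψ : 0 ≤ ψ) (hτ : 0 ≤ τ) (hA' : 0 ≤ A') (hlam : 0 ≤ lam) (hQ' : 0 ≤ Q')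
    (hμ0 : ∀ m, 0 ≤ μ m) (hprof : ∀ m, 1 ≤ m → m ≤ D → μ m ≤ A' * lam ^ (m - 1) * Q' ^ m)
    (hx₁ : 4 * σ * lam * Q' < 1) (hx₂ : 2 * lam * τ * Q' ≤ 1) (hx₃ : exp 1 * τ * lam * Q' < 1)
    (hy : 2 * A' * Φ * τ * Q' < 1) (hθ : Φ * (A' * (exp 1 * τ * Q') / (1 - exp 1 * τ * lam * Q')) < 1)
    {p : ℕ} (hp : 1 ≤ p)
    (hstep : ∀ N : ℕ, 2 ≤ N → Φ * towerV D τ μ < 1 →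
      b ≤ towerFO D σ μ p + ∑ n ∈ Icc 2 N, exp 1 * Φ ^ (n - 1) * ψ ^ p * towerS D τ μ n p +
        ψ ^ p * exp 1 * towerV D τ μ * (Φ * towerV D τ μ) ^ N / (1 - Φ * towerV D τ μ)) :
    b ≤ A' * lam ^ (p - 1) * ((4 * Q') ^ p * (4 * σ * lam * Q' / (1 - 4 * σ * lam * Q')) +
      exp 1 * (2 * τ * ψ * Q') ^ p * (2 * A' * Φ * τ * Q' / (1 - 2 * A' * Φ * τ * Q'))) := by
  -- the field-weighted norm and the convergence ratio
  set V := towerV D τ μ with hVdef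
  set Vb := A' * (exp 1 * τ * Q') / (1 - exp 1 * τ * lam * Q') with hVb
  have hV0 : 0 ≤ V := towerV_nonneg hτ hμ0
  have hVle : V ≤ Vb := towerV_le hτ hA' hlam hQ' hμ0 hprof hx₃
  have hθ0 : 0 ≤ Φ * V := mul_nonneg hΦ hV0
  have hθle : Φ * V ≤ Φ * Vb := mul_le_mul_of_nonneg_left hVle hΦ
  have hθ1 : Φ * V < 1 := hθle.trans_lt hθ
  have hθb0 : 0 ≤ Φ * Vb := hθ0.trans hθle
  set y := 2 * A' * Φ * τ * Q' with hydef
  have hy0 : 0 ≤ y := by positivity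
  -- the closed forms
  set F := A' * lam ^ (p - 1) * (4 * Q') ^ p * (4 * σ * lam * Q' / (1 - 4 * σ * lam * Q')) with hF
  set M := exp 1 * A' * lam ^ (p - 1) * (2 * τ * ψ * Q') ^ p with hM
  have hM0 : 0 ≤ M := by positivity
  set T : ℕ → ℝ := fun N => ψ ^ p * exp 1 * Vb * (Φ * Vb) ^ N / (1 - Φ * Vb) with hT
  -- graded partial sums
  have hG : ∀ N, ∑ n ∈ Icc 2 N, exp 1 * Φ ^ (n - 1) * ψ ^ p * towerS D τ μ n p ≤ M * (y / (1 - y)) := by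
    intro N
    have hterm : ∀ n ∈ Icc 2 N, exp 1 * Φ ^ (n - 1) * ψ ^ p * towerS D τ μ n p ≤ M * y ^ (n - 1) := by
      intro n hn
      have hn1 : 1 ≤ n := by have := (mem_Icc.1 hn).1; omega
      have hS := towerS_le hτ hA' hlam hQ' hμ0 hprof hx₂ hn1 hp
      calc exp 1 * Φ ^ (n - 1) * ψ ^ p * towerS D τ μ n p
          ≤ exp 1 * Φ ^ (n - 1) * ψ ^ p * (A' ^ n * lam ^ (p - 1) * (2 * τ * Q') ^ (p + n - 1)) := by
            have := towerS_nonneg hτ hμ0 n p (D := D); gcongr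
        _ = M * y ^ (n - 1) := by
            obtain ⟨j, rfl⟩ : ∃ j, n = j + 1 := ⟨n - 1, by omega⟩
            have hpj : p + (j + 1) - 1 = p + j := by omega
            rw [hpj, Nat.add_sub_cancel, hM, hydef, pow_add, pow_succ, mul_pow, mul_pow, mul_pow, mul_pow, mul_pow, mul_pow, mul_pow]
            ring
    refine (sum_le_sum hterm).trans ?_
    rw [← mul_sum]
    exact mul_le_mul_of_nonneg_left (sum_Icc_two_pow_sub_one_le hy0 hy N) hM0
  -- the tail, monotone in `V`
  have hTail : ∀ N, ψ ^ p * exp 1 * V * (Φ * V) ^ N / (1 - Φ * V) ≤ T N := by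
    intro N
    have h1 : 0 < 1 - Φ * Vb := sub_pos.2 hθ
    have h2 : 1 - Φ * Vb ≤ 1 - Φ * V := by linarith
    rw [hT]
    dsimp only
    rw [div_eq_mul_inv, div_eq_mul_inv]
    have hinv : (1 - Φ * V)⁻¹ ≤ (1 - Φ * Vb)⁻¹ := inv_anti₀ h1 h2
    have hpowN : (Φ * V) ^ N ≤ (Φ * Vb) ^ N := pow_le_pow_left₀ hθ0 hθle N
    have : 0 ≤ (1 - Φ * V)⁻¹ := inv_nonneg.2 (sub_nonneg.2 hθ1.le)
    gcongr
  -- every `N ≥ 2`: `b ≤ F + M y/(1-y) + T N`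
  have hFO := towerFO_le hσ hA' hlam hQ' hμ0 hprof hx₁ hp (D := D)
  have hbN : ∀ N, 2 ≤ N → b ≤ F + M * (y / (1 - y)) + T N := fun N hN =>
    (hstep N hN hθ1).trans (add_le_add_three hFO (hG N) (hTail N))
  -- `T N → 0`
  have hTto : Filter.Tendsto T Filter.atTop (nhds 0) := by
    have h := (tendsto_pow_atTop_nhds_zero_of_lt_one hθb0 hθ).mul_const ((1 - Φ * Vb)⁻¹) |>.const_mul (ψ ^ p * exp 1 * Vb)
    rw [zero_mul, mul_zero] at h
    refine h.congr' (Filter.Eventually.of_forall fun N => ?_)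
    rw [hT]
    dsimp only
    rw [div_eq_mul_inv]
    ring
  have hlim : Filter.Tendsto (fun N => F + M * (y / (1 - y)) + T N) Filter.atTop (nhds (F + M * (y / (1 - y)))) := by
    have := hTto.const_add (F + M * (y / (1 - y)))
    rwa [add_zero] at this
  have hble : b ≤ F + M * (y / (1 - y)) :=
    ge_of_tendsto hlim (Filter.eventually_atTop.2 ⟨2, fun N hN => hbN N hN⟩)
  refine hble.trans (le_of_eq ?_)
  rw [hF, hM]
  ring


/-! ## §3 (T3) The induction over blocks -/

/-- **(T3) The blocked birth-level tower closes: the born sizes obey the two-constant law at every block boundary.**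
Data: born sizes `b k p` (boundary `k ≤ K`, half-degree `3 ≤ p ≤ D`, in units of `2^{(3p−5)J_k}`), measured input sizes `μ k m` of the block step
`k → k+1` (`1 ≤ m ≤ D`), all nonnegative.  Hypotheses: (H0) the UV profile `b 0 p ≤ A λ^{p−1} Q^p`; (Hμ) blocked re-measurement with the relative
sector count, `μ k m ≤ Σ_{k'≤k} c₁ c₂^m g^{(m−2)(k+1−k')} b k' m` for `m ≥ 3`, and the two IMPORTED degrees inside the measured profile
(`A' ≥ c₁A/((1−g)g²)`, `Q' ≥ c₂ g Q`): `μ k 1 ≤ A'Q'` (two-leg slot + frame shift), `μ k 2 ≤ A'λQ'²` (value line); (Hstep) the block step in the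
suppliers' form (first order binomial–Gram + graded orders `2…N` + tail, every `N ≥ 2`, under the guard `ΦV < 1`); (Hnum) the smallness conditions of
`towerStep_le_profile`, the BLOCKING conditions `4Q' ≤ Q`, `2τψQ' ≤ Q` (i.e. `4c₂g ≤ 1`, `2τψc₂g ≤ 1`: the block length), and the closing
inequality at `p = 3`, `A'[(4Q')³ x₁/(1−x₁) + e(2τψQ')³ y/(1−y)] ≤ A Q³` (the amplitude condition).  Conclusion:
`∀ k ≤ K, ∀ 3 ≤ p ≤ D, b k p ≤ A λ^{p−1} Q^p` — uniformly in `D`, `K`, `N`. -/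
theorem towerBorn_le_law {D K : ℕ} {b μ : ℕ → ℕ → ℝ} {A lam Q g c₁ c₂ σ Φ ψ τ A' Q' : ℝ}
    (hA : 0 ≤ A) (hlam : 0 ≤ lam) (hQ : 0 ≤ Q) (hg0 : 0 < g) (hg1 : g < 1) (hc₁ : 0 ≤ c₁) (hc₂ : 0 ≤ c₂)
    (hσ : 0 ≤ σ) (hΦ : 0 ≤ Φ) (hψ : 0 ≤ ψ) (hτ : 0 ≤ τ) (hA'ge : c₁ * A / ((1 - g) * g ^ 2) ≤ A') (hQ'ge : c₂ * g * Q ≤ Q')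
    (hb0 : ∀ k m, 0 ≤ b k m) (hμ0 : ∀ k m, 0 ≤ μ k m)
    (h0 : ∀ p, 3 ≤ p → p ≤ D → b 0 p ≤ A * lam ^ (p - 1) * Q ^ p)
    (hμ : ∀ k < K, ∀ m, 3 ≤ m → m ≤ D →
      μ k m ≤ ∑ k' ∈ range (k + 1), c₁ * c₂ ^ m * g ^ ((m - 2) * (k + 1 - k')) * b k' m)
    (hι₁ : ∀ k < K, μ k 1 ≤ A' * Q') (hι₂ : ∀ k < K, μ k 2 ≤ A' * lam * Q' ^ 2)
    (hstep : ∀ k < K, ∀ N : ℕ, 2 ≤ N → ∀ p, 3 ≤ p → p ≤ D → Φ * towerV D τ (μ k) < 1 →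
      b (k + 1) p ≤ towerFO D σ (μ k) p + ∑ n ∈ Icc 2 N, exp 1 * Φ ^ (n - 1) * ψ ^ p * towerS D τ (μ k) n p +
        ψ ^ p * exp 1 * towerV D τ (μ k) * (Φ * towerV D τ (μ k)) ^ N / (1 - Φ * towerV D τ (μ k)))
    (hx₁ : 4 * σ * lam * Q' < 1) (hx₂ : 2 * lam * τ * Q' ≤ 1) (hx₃ : exp 1 * τ * lam * Q' < 1)
    (hy : 2 * A' * Φ * τ * Q' < 1) (hθ : Φ * (A' * (exp 1 * τ * Q') / (1 - exp 1 * τ * lam * Q')) < 1)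
    (hu₁ : 4 * Q' ≤ Q) (hu₂ : 2 * τ * ψ * Q' ≤ Q)
    (hclose : A' * ((4 * Q') ^ 3 * (4 * σ * lam * Q' / (1 - 4 * σ * lam * Q')) +
      exp 1 * (2 * τ * ψ * Q') ^ 3 * (2 * A' * Φ * τ * Q' / (1 - 2 * A' * Φ * τ * Q'))) ≤ A * Q ^ 3) :
    ∀ k ≤ K, ∀ p, 3 ≤ p → p ≤ D → b k p ≤ A * lam ^ (p - 1) * Q ^ p := by
  have hg1' : 0 < 1 - g := sub_pos.2 hg1
  have hA'0 : 0 ≤ A' := le_trans (by positivity) hA'ge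
  have hQ'0 : 0 ≤ Q' := le_trans (by positivity) hQ'ge
  have hx10 : 0 ≤ 4 * σ * lam * Q' / (1 - 4 * σ * lam * Q') := div_nonneg (by positivity) (sub_nonneg.2 hx₁.le)
  have hy0 : 0 ≤ 2 * A' * Φ * τ * Q' / (1 - 2 * A' * Φ * τ * Q') := div_nonneg (by positivity) (sub_nonneg.2 hy.le)
  -- strong form: all boundaries `≤ k`
  suffices H : ∀ k ≤ K, ∀ k' ≤ k, ∀ p, 3 ≤ p → p ≤ D → b k' p ≤ A * lam ^ (p - 1) * Q ^ p from
    fun k hk p hp hpD => H k hk k le_rfl p hp hpD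
  intro k
  induction k with
  | zero => intro _ k' hk' p hp hpD; rw [Nat.le_zero.1 hk']; exact h0 p hp hpD
  | succ k ih =>
    intro hk1 k' hk' p hp hpD
    have hkK : k < K := Nat.lt_of_succ_le hk1
    have ih' := ih (Nat.le_of_succ_le hk1)
    rcases Nat.lt_succ_iff_lt_or_eq.1 (Nat.lt_succ_of_le hk') with hlt | rfl
    · exact ih' k' (Nat.lt_succ_iff.1 hlt) p hp hpD
    · -- the new boundary `k + 1`: inputs have the measured profile `A' λ^{m-1} Q'^m`
      have hprof : ∀ m, 1 ≤ m → m ≤ D → μ k m ≤ A' * lam ^ (m - 1) * Q' ^ m := by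
        intro m hm1 hmD
        rcases Nat.lt_or_ge m 3 with hm3 | hm3
        · interval_cases m
          · simpa using hι₁ k hkK
          · simpa [pow_one] using hι₂ k hkK
        · have hT1 := towerMeasured_le_profile (D := D) hA hlam hQ hg0 hg1 hc₁ hc₂ hb0 (hμ k hkK) ih' hm3 hmD
          refine hT1.trans ?_
          have : 0 ≤ c₁ * A / ((1 - g) * g ^ 2) := by positivity
          have : 0 ≤ c₂ * g * Q := by positivity
          gcongr
      have hT2 := towerStep_le_profile (D := D) hσ hΦ hψ hτ hA'0 hlam hQ'0 (hμ0 k) hprof hx₁ hx₂ hx₃ hy hθ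
        (p := p) (by omega) (fun N hN hguard => hstep k hkK N hN p hp hpD hguard)
      refine hT2.trans ?_
      -- close: `(4Q')^p ≤ (4Q')^3 Q^{p-3}`, `(2τψQ')^p ≤ (2τψQ')^3 Q^{p-3}`, then the amplitude condition
      obtain ⟨r, rfl⟩ : ∃ r, p = 3 + r := ⟨p - 3, by omega⟩
      have h4 : (4 * Q') ^ (3 + r) ≤ (4 * Q') ^ 3 * Q ^ r := by
        rw [pow_add]; exact mul_le_mul_of_nonneg_left (pow_le_pow_left₀ (by positivity) hu₁ r) (by positivity)
      have h2 : (2 * τ * ψ * Q') ^ (3 + r) ≤ (2 * τ * ψ * Q') ^ 3 * Q ^ r := by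
        rw [pow_add]; exact mul_le_mul_of_nonneg_left (pow_le_pow_left₀ (by positivity) hu₂ r) (by positivity)
      calc A' * lam ^ (3 + r - 1) * ((4 * Q') ^ (3 + r) * (4 * σ * lam * Q' / (1 - 4 * σ * lam * Q')) +
            exp 1 * (2 * τ * ψ * Q') ^ (3 + r) * (2 * A' * Φ * τ * Q' / (1 - 2 * A' * Φ * τ * Q')))
          ≤ A' * lam ^ (3 + r - 1) * ((4 * Q') ^ 3 * Q ^ r * (4 * σ * lam * Q' / (1 - 4 * σ * lam * Q')) +
            exp 1 * ((2 * τ * ψ * Q') ^ 3 * Q ^ r) * (2 * A' * Φ * τ * Q' / (1 - 2 * A' * Φ * τ * Q'))) := by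
            gcongr
        _ = lam ^ (3 + r - 1) * Q ^ r * (A' * ((4 * Q') ^ 3 * (4 * σ * lam * Q' / (1 - 4 * σ * lam * Q')) +
            exp 1 * (2 * τ * ψ * Q') ^ 3 * (2 * A' * Φ * τ * Q' / (1 - 2 * A' * Φ * τ * Q')))) := by ring
        _ ≤ lam ^ (3 + r - 1) * Q ^ r * (A * Q ^ 3) := mul_le_mul_of_nonneg_left hclose (by positivity)
        _ = A * lam ^ (3 + r - 1) * Q ^ (3 + r) := by rw [pow_add]; ring

end Summit.HubbardSuperconductivity.HubbardSuperconductivity.Theorems.EngineV8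

end
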